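import Literature.Geometry.Riemannian.RicciFlowSmoothExtension
import Literature.Geometry.Lorentzian.Hypersurface
import Literature.Geometry.Riemannian.RoundSphere
import Mathlib.Analysis.InnerProductSpace.PiL2
import HarnessLib

/-!
# Flattening a Riemannian metric inside a chart of the maximal atlas

Given a smooth Riemannian metric `h` on a manifold `N` modelled on `ℝᵐ`, a chart `e` of the
MAXIMAL `C^∞` atlas and a smooth cutoff `χ : N → [0, 1]` with `tsupport χ ⊆ e.source`, the
field of bilinear forms

  `x ↦ (1 − χ x) hₓ + χ x ⟪de_x ·, de_x ·⟫`

is again a smooth Riemannian metric (`ContMDiffRiemannianMetric`), `flatten h e χ`: it agrees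
with `h` where `χ = 0` and is the pullback `e^* δ` of the Euclidean metric where `χ = 1`
(`flatten_inner_of_eq_zero`, `flatten_inner_of_eq_one`). This is the standard modification of a
metric near finitely many points used to compute the Gauss–Bonnet integral at the critical
points of a Morse function (the metric is made Euclidean in Morse coordinates, where the index
form `K dA` is then explicit; cf. Chern 1944, §2, and the classical proof of the Poincaré–Hopf
theorem). Smoothness of the modified field is checked through the tree's local chart criterion
for fields of bilinear forms (`contMDiffOn_totalSpaceMk_of_chartRepRaw`). Everything is proved;
the only definitions are the explicit fields `flatBilin`, `flattenInner` and the metric `flatten`.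

## References

* S.-S. Chern, *A simple intrinsic proof of the Gauss–Bonnet formula for closed Riemannian
  manifolds*, Ann. of Math. 45 (1944), §2. [Chern1944]
* B. O'Neill, *Semi-Riemannian geometry* (1983), Ch. 3, p. 55 (Euclidean metric), pp. 90–91.
  [ONeill1983]
-/

noncomputable section

-- nested continuous-linear-map spaces (`E →L E →L ℝ`) need deeper pending instance synthesis
set_option maxSynthPendingDepth 3

open Bundle Set Function Filter Module TopologicalSpace Manifold
open scoped Manifold ContDiff Topology RealInnerProductSpace

namespace Literature.Geometry.Lorentzian

open Literature.Geometry.Riemannian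

section Flatten

variable {Em : Type*} [NormedAddCommGroup Em] [InnerProductSpace ℝ Em] [FiniteDimensional ℝ Em]
  {N : Type*} [TopologicalSpace N] [ChartedSpace Em N] [IsManifold 𝓘(ℝ, Em) ∞ N]


/-- The pullback `⟪de_x ·, de_x ·⟫ = (e^* δ)_x` of the Euclidean metric by the differential of a
chart `e` (meaningful on `e.source`; the tree's `pullbackBilin` of `Riemannian.euclideanMetric`).
[cite: ONeill1983, Ch. 3, p. 55] -/
def flatBilin (e : OpenPartialHomeomorph N Em) (x : N) :
    TangentSpace 𝓘(ℝ, Em) x →L[ℝ] TangentSpace 𝓘(ℝ, Em) x →L[ℝ] ℝ :=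
  pullbackBilin (I := 𝓘(ℝ, Em)) (I' := 𝓘(ℝ, Em)) e (euclideanMetric Em).val x

omit [FiniteDimensional ℝ Em] [IsManifold 𝓘(ℝ, Em) ∞ N] in
/-- `flatBilin e x v w = ⟪de_x v, de_x w⟫`. [cite: ONeill1983, Ch. 3, p. 55] -/
@[simp]
theorem flatBilin_apply (e : OpenPartialHomeomorph N Em) (x : N) (v w : TangentSpace 𝓘(ℝ, Em) x) :
    flatBilin e x v w =
      (euclideanMetric Em).val (e x) (mfderiv 𝓘(ℝ, Em) 𝓘(ℝ, Em) e x v)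
        (mfderiv 𝓘(ℝ, Em) 𝓘(ℝ, Em) e x w) := rfl

/-- The interpolated field `(1 − χ x) hₓ + χ x ⟪de_x ·, de_x ·⟫`. [cite: Chern1944, §2] -/
def flattenInner (h : ContMDiffRiemannianMetric 𝓘(ℝ, Em) ∞ Em (TangentSpace 𝓘(ℝ, Em) : N → Type _))
    (e : OpenPartialHomeomorph N Em) (χ : N → ℝ) (x : N) :
    TangentSpace 𝓘(ℝ, Em) x →L[ℝ] TangentSpace 𝓘(ℝ, Em) x →L[ℝ] ℝ :=
  (1 - χ x) • h.inner x + χ x • flatBilin e x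

omit [FiniteDimensional ℝ Em] in
/-- `flattenInner h e χ x v w = (1 − χ x) h(v, w) + χ x ⟪de v, de w⟫`. [cite: Chern1944, §2] -/
@[simp]
theorem flattenInner_apply (h : ContMDiffRiemannianMetric 𝓘(ℝ, Em) ∞ Em (TangentSpace 𝓘(ℝ, Em) : N → Type _))
    (e : OpenPartialHomeomorph N Em) (χ : N → ℝ) (x : N) (v w : TangentSpace 𝓘(ℝ, Em) x) :
    flattenInner h e χ x v w =
      (1 - χ x) * h.inner x v w +
        χ x * (euclideanMetric Em).val (e x) (mfderiv 𝓘(ℝ, Em) 𝓘(ℝ, Em) e x v)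
          (mfderiv 𝓘(ℝ, Em) 𝓘(ℝ, Em) e x w) := by
  simp [flattenInner]

variable (h : ContMDiffRiemannianMetric 𝓘(ℝ, Em) ∞ Em (TangentSpace 𝓘(ℝ, Em) : N → Type _))
  {e : OpenPartialHomeomorph N Em} (he : e ∈ IsManifold.maximalAtlas 𝓘(ℝ, Em) ∞ N)
  {χ : N → ℝ} (hχ : ContMDiff 𝓘(ℝ, Em) 𝓘(ℝ, ℝ) ∞ χ) (hχ01 : ∀ x, χ x ∈ Icc (0 : ℝ) 1)
  (hχe : tsupport χ ⊆ e.source)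

/-! #### Smoothness of the interpolated field through the chart criterion -/

omit [FiniteDimensional ℝ Em] in
/-- `y ↦ ⟪Dτ(y) ·, Dτ(y) ·⟫` is smooth on an open set on which `τ` is smooth. [folklore] -/
theorem contDiffOn_innerSL_bilinearComp_fderiv {τ : Em → Em} {s : Set Em} (hs : IsOpen s)
    (hτ : ContDiffOn ℝ ∞ τ s) :
    ContDiffOn ℝ ∞ (fun y ↦ (innerSL ℝ : Em →L[ℝ] Em →L[ℝ] ℝ).bilinearComp
      (fderiv ℝ τ y) (fderiv ℝ τ y)) s := by
  have hD : ContDiffOn ℝ ∞ (fderiv ℝ τ) s := hτ.fderiv_of_isOpen (m := ∞) hs (le_of_eq rfl)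
  have h1 : ContDiffOn ℝ ∞ (fun y ↦ ((innerSL ℝ : Em →L[ℝ] Em →L[ℝ] ℝ).comp (fderiv ℝ τ y))) s :=
    contDiffOn_const.clm_comp hD
  let fl : (Em →L[ℝ] Em →L[ℝ] ℝ) →L[ℝ] (Em →L[ℝ] Em →L[ℝ] ℝ) :=
    ((ContinuousLinearMap.flipₗᵢ ℝ Em Em ℝ).toContinuousLinearEquiv :
      (Em →L[ℝ] Em →L[ℝ] ℝ) →L[ℝ] (Em →L[ℝ] Em →L[ℝ] ℝ))
  have hflip : ContDiff ℝ ∞ fl := fl.contDiff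
  have h2 : ContDiffOn ℝ ∞ (fun y ↦ fl ((fl
      ((innerSL ℝ : Em →L[ℝ] Em →L[ℝ] ℝ).comp (fderiv ℝ τ y))).comp (fderiv ℝ τ y))) s :=
    hflip.comp_contDiffOn ((hflip.comp_contDiffOn h1).clm_comp hD)
  refine h2.congr fun y _ ↦ ?_
  ext a b
  rfl

omit [FiniteDimensional ℝ Em] in
include he in
/-- In the chart at `z`, at a point `y` of the target with `φ⁻¹ y ∈ e.source`, the flat part of the
interpolated field read through the frame of the trivialization is `⟪Dτ(y) a, Dτ(y) b⟫`,
`τ = e ∘ φ⁻¹` (chain rule; `dφ⁻¹ = e.symmL`, `mfderiv_chartInv_eq_symmL`). [folklore] -/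
theorem flatBilin_symmL_symmL (z : N) {y : Em} (hy : y ∈ (extChartAt 𝓘(ℝ, Em) z).target)
    (hye : (extChartAt 𝓘(ℝ, Em) z).symm y ∈ e.source)
    (hτd : DifferentiableAt ℝ (e ∘ (extChartAt 𝓘(ℝ, Em) z).symm) y) (a b : Em) :
    flatBilin e ((extChartAt 𝓘(ℝ, Em) z).symm y)
        ((trivializationAt Em (TangentSpace 𝓘(ℝ, Em) : N → Type _) z).symmL ℝ
          ((extChartAt 𝓘(ℝ, Em) z).symm y) a)
        ((trivializationAt Em (TangentSpace 𝓘(ℝ, Em) : N → Type _) z).symmL ℝ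
          ((extChartAt 𝓘(ℝ, Em) z).symm y) b) =
      (innerSL ℝ : Em →L[ℝ] Em →L[ℝ] ℝ).bilinearComp
        (fderiv ℝ (e ∘ (extChartAt 𝓘(ℝ, Em) z).symm) y)
        (fderiv ℝ (e ∘ (extChartAt 𝓘(ℝ, Em) z).symm) y) a b := by
  -- `De (Φ y) ∘ e.symmL (Φ y) = D(e ∘ chartInv) = Dτ y`
  have hcomp : ∀ c : Em, (mfderiv 𝓘(ℝ, Em) 𝓘(ℝ, Em) e ((extChartAt 𝓘(ℝ, Em) z).symm y)
      ((trivializationAt Em (TangentSpace 𝓘(ℝ, Em) : N → Type _) z).symmL ℝ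
        ((extChartAt 𝓘(ℝ, Em) z).symm y) c) : Em) =
      fderiv ℝ (e ∘ (extChartAt 𝓘(ℝ, Em) z).symm) y c := by
    intro c
    have h1 : (trivializationAt Em (TangentSpace 𝓘(ℝ, Em) : N → Type _) z).symmL ℝ
        ((extChartAt 𝓘(ℝ, Em) z).symm y) c =
        mfderiv 𝓘(ℝ, Em) 𝓘(ℝ, Em) (chartInv 𝓘(ℝ, Em) z) ⟨y, hy⟩ c :=
      (mfderiv_chartInv_eq_symmL (I := 𝓘(ℝ, Em)) z ⟨y, hy⟩ c).symm
    have hem : MDifferentiableAt 𝓘(ℝ, Em) 𝓘(ℝ, Em) e (chartInv 𝓘(ℝ, Em) z ⟨y, hy⟩) :=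
      ((contMDiffOn_of_mem_maximalAtlas he).mdifferentiableOn (by simp) _ hye).mdifferentiableAt
        (e.open_source.mem_nhds hye)
    have hΦm : MDifferentiableAt 𝓘(ℝ, Em) 𝓘(ℝ, Em) (chartInv 𝓘(ℝ, Em) z) ⟨y, hy⟩ :=
      ((contMDiff_chartInv z).of_le le_self_add _).mdifferentiableAt (by simp)
    have h2 : mfderiv 𝓘(ℝ, Em) 𝓘(ℝ, Em) e ((extChartAt 𝓘(ℝ, Em) z).symm y)
        (mfderiv 𝓘(ℝ, Em) 𝓘(ℝ, Em) (chartInv 𝓘(ℝ, Em) z) ⟨y, hy⟩ c) =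
        mfderiv 𝓘(ℝ, Em) 𝓘(ℝ, Em) (e ∘ chartInv 𝓘(ℝ, Em) z) ⟨y, hy⟩ c := by
      rw [mfderiv_comp _ hem hΦm]
      rfl
    have h3 : mfderiv 𝓘(ℝ, Em) 𝓘(ℝ, Em) (e ∘ chartInv 𝓘(ℝ, Em) z) ⟨y, hy⟩ =
        fderiv ℝ (e ∘ (extChartAt 𝓘(ℝ, Em) z).symm) y :=
      OpensChart.mfderiv_eq (U := chartTarget 𝓘(ℝ, Em) z) ⟨y, hy⟩ (e ∘ chartInv 𝓘(ℝ, Em) z)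
        (e ∘ (extChartAt 𝓘(ℝ, Em) z).symm) (fun _ ↦ rfl) hτd
    rw [h1, h2, h3]
    rfl
  rw [flatBilin_apply, euclideanMetric_apply, ContinuousLinearMap.bilinearComp_apply,
    innerSL_apply_apply, ← hcomp a, ← hcomp b]
  rfl

omit [FiniteDimensional ℝ Em] in
/-- The raw chart representative of the interpolated field at `z`:
`(1 − χ̂(y)) G(y) + χ̂(y) (flat part)`, `G = chartRep h`, `χ̂ = χ ∘ φ⁻¹`. [folklore] -/
theorem chartRepRaw_flattenInner (z : N) (t : ℝ) (y : Em) :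
    chartRepRaw (fun _ b ↦ flattenInner h e χ b) z t y =
      (1 - χ ((extChartAt 𝓘(ℝ, Em) z).symm y)) •
          chartRep 𝓘(ℝ, Em) (fun _ ↦ PseudoRiemannianMetric.ofRiemannian h) z 0 y +
        χ ((extChartAt 𝓘(ℝ, Em) z).symm y) •
          ContinuousLinearMap.bilinearComp
            (show Em →L[ℝ] Em →L[ℝ] ℝ from flatBilin e ((extChartAt 𝓘(ℝ, Em) z).symm y))
            (show Em →L[ℝ] Em from (trivializationAt Em (TangentSpace 𝓘(ℝ, Em) : N → Type _) z).symmL ℝ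
              ((extChartAt 𝓘(ℝ, Em) z).symm y))
            (show Em →L[ℝ] Em from (trivializationAt Em (TangentSpace 𝓘(ℝ, Em) : N → Type _) z).symmL ℝ
              ((extChartAt 𝓘(ℝ, Em) z).symm y)) := by
  ext a b
  simp only [chartRepRaw_apply, flattenInner, chartRep, gramOpFamily, _root_.add_apply,
    _root_.smul_apply, ContinuousLinearMap.bilinearComp_apply,
    PseudoRiemannianMetric.val_ofRiemannian, smul_eq_mul]
  rfl

include he hχ hχe in
/-- **The interpolated field is a smooth section of the bundle of bilinear forms**: near a point
of `tsupport χ ⊆ e.source` its representative in the chart at `z` is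
`(1 − χ̂) G + χ̂ ⟪Dτ ·, Dτ ·⟫` with `G = chartRep h`, `χ̂ = χ ∘ φ⁻¹`, `τ = e ∘ φ⁻¹` smooth (the charts
are `C^∞`-compatible); near a point off `tsupport χ` it is `G`. [folklore] -/
theorem contMDiff_flattenInner :
    ContMDiff 𝓘(ℝ, Em) (𝓘(ℝ, Em).prod 𝓘(ℝ, Em →L[ℝ] Em →L[ℝ] ℝ)) ∞
      (fun x : N ↦ TotalSpace.mk' (Em →L[ℝ] Em →L[ℝ] ℝ)
        (E := fun b : N ↦ TangentSpace 𝓘(ℝ, Em) b →L[ℝ] TangentSpace 𝓘(ℝ, Em) b →L[ℝ] ℝ) x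
        (flattenInner h e χ x)) := by
  -- the chart criterion for the constant-in-time family
  have hfam : ContMDiffOn (𝓘(ℝ, Em).prod 𝓘(ℝ, ℝ)) (𝓘(ℝ, Em).prod 𝓘(ℝ, Em →L[ℝ] Em →L[ℝ] ℝ)) ∞
      (fun p : N × ℝ ↦ TotalSpace.mk' (Em →L[ℝ] Em →L[ℝ] ℝ)
        (E := fun b : N ↦ TangentSpace 𝓘(ℝ, Em) b →L[ℝ] TangentSpace 𝓘(ℝ, Em) b →L[ℝ] ℝ) p.1
        ((fun (_ : ℝ) (b : N) ↦ flattenInner h e χ b) p.2 p.1))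
      (univ ×ˢ (univ : Set ℝ)) := by
    refine contMDiffOn_totalSpaceMk_of_chartRepRaw (I := 𝓘(ℝ, Em)) (S := (univ : Set ℝ))
      (fun (_ : ℝ) (b : N) ↦ flattenInner h e χ b) fun z ↦ ?_
    have hTo : IsOpen (extChartAt 𝓘(ℝ, Em) z).target := isOpen_extChartAt_target z
    have hzT : extChartAt 𝓘(ℝ, Em) z z ∈ (extChartAt 𝓘(ℝ, Em) z).target := mem_extChartAt_target z
    have hGs : ContDiffOn ℝ ∞ (chartRep 𝓘(ℝ, Em) (fun _ ↦ PseudoRiemannianMetric.ofRiemannian h) z 0)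
        (extChartAt 𝓘(ℝ, Em) z).target :=
      contDiffOn_chartRep_const (PseudoRiemannianMetric.ofRiemannian h) z
    -- `χ̂ = χ ∘ Φ` is smooth on the target
    have hχT : ContDiffOn ℝ ∞ (χ ∘ (extChartAt 𝓘(ℝ, Em) z).symm) (extChartAt 𝓘(ℝ, Em) z).target := by
      rw [← contMDiffOn_iff_contDiffOn]
      exact hχ.comp_contMDiffOn (contMDiffOn_extChartAt_symm z)
    by_cases hz : z ∈ tsupport χ
    · -- near a point of the support: `τ = e ∘ Φ` is smooth on `T' = target ∩ Φ⁻¹ e.source`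
      have hze : z ∈ e.source := hχe hz
      set T' : Set Em := (extChartAt 𝓘(ℝ, Em) z).target ∩ (extChartAt 𝓘(ℝ, Em) z).symm ⁻¹' e.source
        with hT'
      have hT'o : IsOpen T' :=
        (continuousOn_extChartAt_symm z).isOpen_inter_preimage hTo e.open_source
      have hτs : ContDiffOn ℝ ∞ (e ∘ (extChartAt 𝓘(ℝ, Em) z).symm) T' := by
        rw [← contMDiffOn_iff_contDiffOn]
        exact (contMDiffOn_of_mem_maximalAtlas he).comp
          ((contMDiffOn_extChartAt_symm z).mono inter_subset_left) fun y hy ↦ hy.2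
      have hFls := contDiffOn_innerSL_bilinearComp_fderiv hT'o hτs
      refine ⟨T', hT'o.mem_nhds ⟨hzT, ?_⟩, ?_⟩
      · show (extChartAt 𝓘(ℝ, Em) z).symm (extChartAt 𝓘(ℝ, Em) z z) ∈ e.source
        rwa [extChartAt_to_inv]
      have hmain : ContDiffOn ℝ ∞ (fun y ↦
          (1 - χ ((extChartAt 𝓘(ℝ, Em) z).symm y)) •
              chartRep 𝓘(ℝ, Em) (fun _ ↦ PseudoRiemannianMetric.ofRiemannian h) z 0 y +
            χ ((extChartAt 𝓘(ℝ, Em) z).symm y) •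
              (innerSL ℝ : Em →L[ℝ] Em →L[ℝ] ℝ).bilinearComp
                (fderiv ℝ (e ∘ (extChartAt 𝓘(ℝ, Em) z).symm) y)
                (fderiv ℝ (e ∘ (extChartAt 𝓘(ℝ, Em) z).symm) y)) T' :=
        ((contDiffOn_const.sub (hχT.mono inter_subset_left)).smul (hGs.mono inter_subset_left)).add
          ((hχT.mono inter_subset_left).smul hFls)
      refine (hmain.comp contDiffOn_fst fun q hq ↦ hq.1).congr fun q hq ↦ ?_
      have hτd : DifferentiableAt ℝ (e ∘ (extChartAt 𝓘(ℝ, Em) z).symm) q.1 :=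
        (hτs.differentiableOn (by simp) q.1 hq.1).differentiableAt (hT'o.mem_nhds hq.1)
      rw [Function.comp_apply, chartRepRaw_flattenInner]
      congr 2
      ext a b
      exact flatBilin_symmL_symmL he z hq.1.1 hq.1.2 hτd a b
    · -- off the support the field is `h`
      set T'' : Set Em := (extChartAt 𝓘(ℝ, Em) z).target ∩
        (extChartAt 𝓘(ℝ, Em) z).symm ⁻¹' (tsupport χ)ᶜ with hT''
      have hT''o : IsOpen T'' :=
        (continuousOn_extChartAt_symm z).isOpen_inter_preimage hTo (isClosed_tsupport χ).isOpen_compl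
      refine ⟨T'', hT''o.mem_nhds ⟨hzT, ?_⟩, ?_⟩
      · show (extChartAt 𝓘(ℝ, Em) z).symm (extChartAt 𝓘(ℝ, Em) z z) ∈ (tsupport χ)ᶜ
        rwa [extChartAt_to_inv]
      refine ((hGs.mono inter_subset_left).comp contDiffOn_fst fun q hq ↦ hq.1).congr fun q hq ↦ ?_
      rw [Function.comp_apply, chartRepRaw_flattenInner, image_eq_zero_of_notMem_tsupport hq.1.2]
      simp
  -- restrict the family to `t = 0`
  have hι : ContMDiff 𝓘(ℝ, Em) (𝓘(ℝ, Em).prod 𝓘(ℝ, ℝ)) ∞ (fun x : N ↦ (x, (0 : ℝ))) :=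
    contMDiff_id.prodMk contMDiff_const
  exact hfam.comp_contMDiff hι fun x ↦ ⟨mem_univ _, mem_univ _⟩

omit [FiniteDimensional ℝ Em] in
include he hχ01 in
/-- Positivity of the interpolated field: where `χ x > 0` the point lies in `e.source`, so `de_x`
is injective and `⟪de v, de v⟫ > 0`. [folklore] -/
theorem flattenInner_pos (x : N) (v : TangentSpace 𝓘(ℝ, Em) x) (hv : v ≠ 0)
    (hsupp : Function.support χ ⊆ e.source) : 0 < flattenInner h e χ x v v := by
  rw [flattenInner_apply]
  obtain ⟨h0, h1⟩ := hχ01 x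
  have hh : 0 < h.inner x v v := h.pos x v hv
  rcases h0.lt_or_eq with hpos | hzero
  · have hx : x ∈ e.source := hsupp (by simpa [Function.mem_support] using hpos.ne')
    have hinj : Function.Injective (mfderiv 𝓘(ℝ, Em) 𝓘(ℝ, Em) e x) :=
      ((contMDiffOn_of_mem_maximalAtlas he).mdifferentiableOn (by simp) x hx |>.mdifferentiableAt
        (e.open_source.mem_nhds hx)) |> fun _ ↦
        (OpenPartialHomeomorph.MDifferentiable.mfderiv_injective
          ⟨(contMDiffOn_of_mem_maximalAtlas he).mdifferentiableOn (by simp),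
            (contMDiffOn_symm_of_mem_maximalAtlas he).mdifferentiableOn (by simp)⟩ hx)
    have hne : (mfderiv 𝓘(ℝ, Em) 𝓘(ℝ, Em) e x v : Em) ≠ 0 := fun h0' ↦ hv (hinj (by rw [h0', map_zero]))
    have hflat : 0 < (euclideanMetric Em).val (e x) (mfderiv 𝓘(ℝ, Em) 𝓘(ℝ, Em) e x v)
        (mfderiv 𝓘(ℝ, Em) 𝓘(ℝ, Em) e x v) := isRiemannian_euclideanMetric _ _ hne
    have h1' : 0 ≤ 1 - χ x := by linarith
    nlinarith [mul_nonneg h1' hh.le, mul_pos hpos hflat]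
  · rw [← hzero]
    simpa using hh

/-- **The flattened metric**: `(1 − χ) h + χ e^*δ` as a smooth Riemannian metric on `TN`.
[cite: Chern1944, §2] -/
def flatten : ContMDiffRiemannianMetric 𝓘(ℝ, Em) ∞ Em (TangentSpace 𝓘(ℝ, Em) : N → Type _) where
  inner := flattenInner h e χ
  symm x v w := by
    rw [flattenInner_apply, flattenInner_apply, h.symm x v w, (euclideanMetric Em).symm]
  pos x v hv := flattenInner_pos h he hχ01 x v hv ((subset_tsupport χ).trans hχe)
  isVonNBounded x := PseudoRiemannianMetric.IsSpacelikeImmersion.isVonNBounded_setOf_lt_one_of_pos (V := Em) (flattenInner h e χ x)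
    fun v hv ↦ flattenInner_pos h he hχ01 x v hv ((subset_tsupport χ).trans hχe)
  contMDiff := contMDiff_flattenInner h he hχ hχe

/-- The scalar product of the flattened metric. [cite: Chern1944, §2] -/
@[simp]
theorem flatten_inner : (flatten h he hχ hχ01 hχe).inner = flattenInner h e χ := rfl

/-- **Off the cutoff the flattened metric is the original one.** [cite: Chern1944, §2] -/
theorem flatten_inner_of_eq_zero {x : N} (hx : χ x = 0) :
    (flatten h he hχ hχ01 hχe).inner x = h.inner x := by
  ext v w
  simp [flatten_inner, flattenInner_apply, hx]

/-- **Where the cutoff is `1` the flattened metric is the Euclidean metric in the chart `e`.**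
[cite: Chern1944, §2] -/
theorem flatten_inner_of_eq_one {x : N} (hx : χ x = 1) (v w : TangentSpace 𝓘(ℝ, Em) x) :
    (flatten h he hχ hχ01 hχe).inner x v w =
      (euclideanMetric Em).val (e x) (mfderiv 𝓘(ℝ, Em) 𝓘(ℝ, Em) e x v)
        (mfderiv 𝓘(ℝ, Em) 𝓘(ℝ, Em) e x w) := by
  simp [flatten_inner, flattenInner_apply, hx]

/-- Off `tsupport χ` the flattened metric is the original one. [cite: Chern1944, §2] -/
theorem flatten_inner_of_notMem_tsupport {x : N} (hx : x ∉ tsupport χ) :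
    (flatten h he hχ hχ01 hχe).inner x = h.inner x :=
  flatten_inner_of_eq_zero h he hχ hχ01 hχe (image_eq_zero_of_notMem_tsupport hx)

end Flatten

end Literature.Geometry.Lorentzian

end
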